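import Summits.BirchSwinnertonDyer.Rank1Residual.X11b.Three.KolyvaginShaThreeBSDpClause
import Summits.BirchSwinnertonDyer.Rank1Residual.X11b.KolyvaginLeafInputsDischarged
import Literature.NumberTheory.GaloisCohomology.PoitouTateNumberField
import HarnessLib

/-!
# `Ш(E/ℚ)[3^∞]` on the class X11b @ 3 ∩ (KN₃)/ℚ modulo ONE cite-only input `hγ`
# (the ℚ-side Kolyvagin ENDs at `3` with `hPT`, `hrec`, `hCM`, `h53` DISCHARGED)

Cell `b2b-bsdres`, team x11b3 (N8/O2 = X11b @ 3); seat x11b3-p2 GEN 52 (unit claimed D-0075 →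
BSD:K2/P4 «Kolyvagin-in-kernel»).  Summit-side THEOREM-ONLY file (no definition, no named fact,
no `sorry`); `K : Type`.

HONEST FRAMING (cell `b2b-bsdres`, run/shared/lean/b2b/bsd-rank1-residual/, verbatim in every
file): the goal of the cell is to DELETE the COMBINATION-SHAPED residual classes of the
Birch–Swinnerton-Dyer formula for ALL analytic-rank `≤ 1` elliptic curves over `ℚ` — "full BSD
formula for every rank `≤ 1` curve in class `C`" assembled STRICTLY from published theorems — so
that the rank-`≤ 1` remainder becomes exactly the CONSTRUCTION-SHAPED classes, which are TYPED
(missing-input `Prop`s), NOT attempted.  This is not "finishing BSD".  The X11b @ 3 class stays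
OPEN; nothing here is booked; no mark / label / count / tier moves.

WHAT THIS FILE DOES.  The ℚ-side ENDs of this seat's (P2-QUANT) telescope,
`Three/KolyvaginShaThreeDescentToQ` (§2, p389643-era) and `Three/KolyvaginShaThreeBSDpClause`
(`finite_primaryComponent_sha_three_of_classX11b_of_kodairaNeron_of_facts`), are CONDITIONAL on
EXACTLY the five labelled cite-only inputs {`hPT`, `hrec`, `hCM`, `h53`, `hγ`} at `3`.  FOUR of
them are now KERNEL THEOREMS of the tree (2026-08-27):
`hPT = GaloisCohomology.poitouTate_sum_localTatePairing_eq_zero_holds K` (Poitou–Tate, every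
number field), `hrec = heegnerPointOfConductor_one_galoisConj_holds N W K`,
`hCM = KolyvaginLeaves.hCM_holds N W K 3`, `h53 = KolyvaginLeaves.h53_holds hN 3`
(`X11b/KolyvaginLeafInputsDischarged`: Gross §3 CM rationality and Prop. 5.3 at every Kolyvagin
level from the complex-multiplication theorems `HeegnerPointsOfConductorRationalityProofs` /
`HeegnerPointsOfConductorGaloisOrbitProofs` and this seat's reduction `KolyvaginA53.h53_of_recM`).
THIS FILE re-issues those ENDs with the four labels SUPPLIED, every other binder and every
conclusion VERBATIM — so that on X11b @ 3 ∩ (KN₃)/ℚ the finiteness of `Ш(E/ℚ)[3^∞]`, its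
annihilation by `3^{2m}` when `3^{m+1} ∤ y_K`, and its vanishing when `3 ∤ y_K` rest on EXACTLY
ONE cite-only input at `3`: `hγ` = Gross 1991 Prop. 3.7 (2), the Eichler–Shimura congruence
`y_m ≡ Frob(λ)·y_{m/ℓ}` modulo every prime above an inert Kolyvagin prime `ℓ` (not in the tree:
it needs the Eichler–Shimura relation on the reduction of `X₀(N)` mod `ℓ`) — plus, for the
`(K, y_K)`-free form, the published NAMED FACTS {Gross–Zagier `gross_zagier`, `hasEntireLFunction_rat`,
modularity `exists_isNewformOf`, Hoffstein–Luo, Mazur's Manin-constant theorem}.  Proof of each: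
one application of the parent END.  Nothing else is claimed; nothing booked.

## What is proved (namespace `Summit.BirchSwinnertonDyer.Rank1Residual.X11b.Three.KolyvaginDischarged`)

* `finite_primaryComponent_sha_three_of_classX11b_of_kodairaNeron_rat` — X11b @ 3 ∩ (KN₃)/ℚ, any
  imaginary quadratic Heegner `K` with a non-torsion Heegner point: `Ш(E/ℚ)[3^∞]` finite, modulo
  {`hγ`} + `hN`.
* `pow_smul_sha_rat_three_primary_eq_zero_of_classX11b_of_kodairaNeron_rat` — same class:
  `3^{m+1} ∤ y_K ⟹ 3^{2m} · Ш(E/ℚ)[3^∞] = 0`, modulo {`hγ`} + `hN`.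
* `primaryComponent_sha_three_eq_bot_of_classX11b_of_kodairaNeron_rat_of_not_dvd` — same class:
  `3 ∤ y_K ⟹ Ш(E/ℚ)[3^∞] = ⊥`, modulo {`hγ`} + `hN`.
* **`finite_primaryComponent_sha_three_of_classX11b_of_kodairaNeron_of_facts`** — X11b @ 3 ∩
  (KN₃)/ℚ, NO `(K, y_K)` hypothesis: `Ш(E/ℚ)[3^∞]` finite (clause (ii) of `BSDp W 3` verbatim)
  modulo the named facts {`gross_zagier`, `hasEntireLFunction_rat`, `exists_isNewformOf`,
  `HoffsteinLuo1997_exists_twist_L_one_ne_zero`, `mazur_not_dvd_maninConstant_of_odd`} and the ONE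
  cite-only input `hγ` at `3` (for every `K : Type`).

## References

* [McCallumLMS1991] W. G. McCallum, *Kolyvagin's work on Shafarevich–Tate groups*, LMS LNS 153
  (1991), §1 Theorem (Kolyvagin), Lemma 5.1.
* [GrossLMS1991] B. H. Gross, *Kolyvagin's work on modular elliptic curves*, same volume, §3
  Prop. 3.7 (2), Prop. 2.1 (2), Prop. 5.3, Thm. 1.3 (2).
* [Miller2011LMS] R. L. Miller, *Proving the Birch and Swinnerton-Dyer conjecture for specific
  elliptic curves of analytic rank zero and one*, LMS J. Comput. Math. 14 (2011), Def. 1.1 (ii).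
* [HoffsteinLuo1997] J. Hoffstein, W. Luo, *Nonvanishing of `L`-series and the combinatorial
  sieve*, Math. Res. Lett. 4 (1997), Theorem (§1). [GrossZagier1986] III (3.1), I (6.3).
* [SerreGaloisCohomology1997] J.-P. Serre, *Galois Cohomology*, I.§2.4.

presearch: `lean search 'KolyvaginDischarged|of_kodairaNeron_rat_of_gamma'` → none; parents =
tree ENDs `Three.finite_primaryComponent_sha_three_of_classX11b_of_kodairaNeron_rat` /
`…_of_facts` (this seat, GEN 36/41); dischargers = tree theorems of 2026-08-27 (see
`X11b/KolyvaginLeafInputsDischarged`); [corpus:book:editornd-l-functions-arithmetic chunk 216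
(Prop. 3.7)] for the remaining input; nothing minted.
-/

noncomputable section

open scoped Classical
open WeierstrassCurve Field NumberField IsDedekindDomain
open Literature.NumberTheory.EllipticCurves Literature.NumberTheory.GaloisRepresentations
open Literature.NumberTheory.EllipticCurves.Rank1Residual
open Literature.NumberTheory.EllipticCurves.RingClassField
open Literature.NumberTheory.EllipticCurves.ModularForms
open Literature.NumberTheory.DiophantineGeometry Literature.NumberTheory.DiophantineGeometry.TateAlgorithm
open Literature.NumberTheory.GaloisCohomology (poitouTate_sum_localTatePairing_eq_zero_holds)
open Summit.BirchSwinnertonDyer.Rank1Residual.X11b.KolyvaginAssembly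

namespace Summit.BirchSwinnertonDyer.Rank1Residual.X11b.Three.KolyvaginDischarged

-- `K : Type`: the tree's ring-class class field theory is universe `0`.
variable {K : Type} [Field K] [NumberField K] {N : ℕ} {W : WeierstrassCurve ℚ}

/-- **On the class X11b @ 3 ∩ (KN₃)/ℚ, `Ш(E/ℚ)[3^∞]` is finite — clause (ii) of Miller's
`BSD(E, 3)` — modulo ONE cite-only input `hγ` at `3`.**  The tree END
`Three.finite_primaryComponent_sha_three_of_classX11b_of_kodairaNeron_rat` (FIVE labels) with
`hPT`, `hrec`, `hCM`, `h53` SUPPLIED by `poitouTate_sum_localTatePairing_eq_zero_holds K`,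
`heegnerPointOfConductor_one_galoisConj_holds N W K`, `KolyvaginLeaves.hCM_holds N W K 3`,
`KolyvaginLeaves.h53_holds hN 3`.  For `(E, 3) ∈ ClassX11b W 3` at `N = N_E` (`hN`), (KN₃)/ℚ
(`hKN3m`, `hKN3a`), ANY `K : Type` imaginary quadratic with the Heegner hypothesis and a
non-torsion Heegner point `P`: `Finite (AddCommGroup.primaryComponent W.sha 3)`.  CONDITIONAL on
EXACTLY {`hγ`} (Gross Prop. 3.7 (2) at `3`; cite-only, NOT discharged) + `hN` + (KN₃)/ℚ; `(K, P)`
NOT supplied; nothing booked; no mark / count / tier moves.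
[cite: Miller2011LMS, Def. 1.1 (ii)] [cite: McCallumLMS1991, §1 Theorem (Kolyvagin)]
[cite: GrossLMS1991, §3 Prop. 3.7 (2)] [cite: SerreGaloisCohomology1997, I.§2.4] -/
theorem finite_primaryComponent_sha_three_of_classX11b_of_kodairaNeron_rat [NeZero N]
    [W.IsGloballyMinimal] (hW : ClassX11b W 3) (hN : ∀ [W.IsElliptic], N = W.conductorNorm ℤ)
    (hKN3m : ∀ [W.IsElliptic] (v : HeightOneSpectrum (𝓞 ℚ)),
      W.HasMultiplicativeReductionAt v → ¬ 3 ∣ W.ordMinimalDiscriminant v)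
    (hKN3a : ∀ [W.IsElliptic] (v : HeightOneSpectrum (𝓞 ℚ)), W.HasAdditiveReductionAt v →
      W.kodairaSymbolAt v ≠ KodairaSymbol.IV ∧ W.kodairaSymbolAt v ≠ KodairaSymbol.IVstar)
    (hγ : ∀ [W.IsElliptic] (_hK : IsImaginaryQuadratic K) (_hH : SatisfiesHeegnerHypothesis N K)
      (Dt : ModularParametrizationData W N) (β : ℤ) (ι : K →+* ℂ) {M : ℕ}
      (_hM : 1 ≤ M) {n : ℕ} (_hn : Squarefree n)
      (_hKol : ∀ q ∈ n.primeFactors, IsKolyvaginPrime N W K 3 q ∧ FrobEqFrobInfty W K (3 ^ M) q)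
      (d : (m : ℕ) → m ∣ n → KolyvaginHeegnerData Dt β ι m)
      (m : ℕ) (hm : m ∣ n) (ℓ : ℕ) (hℓ : ℓ ∈ m.primeFactors) [Fact ℓ.Prime]
      (hΔ : ¬ (ℓ : ℤ) ∣ minimalDiscriminantInt W) (φ₀ : absoluteGaloisGroup (ZMod ℓ)),
      (∀ x : AlgebraicClosure (ZMod ℓ), φ₀ • x = x ^ ℓ) →
      ∀ (hle : ringClassField K ι (m / ℓ) ≤ ringClassField K ι m)
        (γ : ringClassField K ι m ≃ₐ[ℚ] ringClassField K ι m), γ ∈ ringClassGal ι m →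
        geomReduction hΔ ((RatClosure.pointsEquiv (K := K) W).symm
            ((d m hm).toGeomPoints (pointGalHom W (ringClassField K ι m) γ (d m hm).y))) =
          φ₀ • geomReduction hΔ ((RatClosure.pointsEquiv (K := K) W).symm
            ((d m hm).toGeomPoints (pointGalHom W (ringClassField K ι m) γ
              (WeierstrassCurve.Affine.Point.map (W' := W)
                ((RingClassField.inclusion ι hle).restrictScalars ℚ)
                (d (m / ℓ)
                  ((Nat.div_dvd_of_dvd (Nat.dvd_of_mem_primeFactors hℓ)).trans hm)).y))))) :
    ∀ [W.IsElliptic] (_hK : IsImaginaryQuadratic K) (_hH : SatisfiesHeegnerHypothesis N K)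
      {P : (W.baseChange K).toAffine.Point} (_hP : IsHeegnerPoint N W K P)
      (_hnt : ¬ IsOfFinAddOrder P), Finite (AddCommGroup.primaryComponent W.sha 3) :=
  Three.finite_primaryComponent_sha_three_of_classX11b_of_kodairaNeron_rat hW
    (poitouTate_sum_localTatePairing_eq_zero_holds K) hN
    (heegnerPointOfConductor_one_galoisConj_holds N W K) (KolyvaginLeaves.hCM_holds N W K 3)
    (@fun _ ↦ KolyvaginLeaves.h53_holds hN 3) hKN3m hKN3a hγ

/-- **On the class X11b @ 3 ∩ (KN₃)/ℚ, `3^{2m} · Ш(E/ℚ)[3^∞] = 0` for every `m` with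
`3^{m+1} ∤ y_K` in `E(K)` — modulo ONE cite-only input `hγ` at `3`** (the EXPONENT form over `ℚ`
of McCallum's §1 Theorem with Lemma 5.1).  The tree END
`Three.pow_smul_sha_rat_three_primary_eq_zero_of_classX11b_of_kodairaNeron_rat` with `hPT`, `hrec`,
`hCM`, `h53` SUPPLIED by the tree theorems; every other binder and the conclusion VERBATIM.
CONDITIONAL on EXACTLY {`hγ`} at `3` + `hN` + (KN₃)/ℚ; nothing booked; no mark.
[cite: McCallumLMS1991, §1 Theorem (Kolyvagin), Lemma 5.1] [cite: GrossLMS1991, §3 Prop. 3.7 (2)]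
[cite: SerreGaloisCohomology1997, I.§2.4] -/
theorem pow_smul_sha_rat_three_primary_eq_zero_of_classX11b_of_kodairaNeron_rat [NeZero N]
    [W.IsGloballyMinimal] (hW : ClassX11b W 3) (hN : ∀ [W.IsElliptic], N = W.conductorNorm ℤ)
    (hKN3m : ∀ [W.IsElliptic] (v : HeightOneSpectrum (𝓞 ℚ)),
      W.HasMultiplicativeReductionAt v → ¬ 3 ∣ W.ordMinimalDiscriminant v)
    (hKN3a : ∀ [W.IsElliptic] (v : HeightOneSpectrum (𝓞 ℚ)), W.HasAdditiveReductionAt v →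
      W.kodairaSymbolAt v ≠ KodairaSymbol.IV ∧ W.kodairaSymbolAt v ≠ KodairaSymbol.IVstar)
    (hγ : ∀ [W.IsElliptic] (_hK : IsImaginaryQuadratic K) (_hH : SatisfiesHeegnerHypothesis N K)
      (Dt : ModularParametrizationData W N) (β : ℤ) (ι : K →+* ℂ) {M : ℕ}
      (_hM : 1 ≤ M) {n : ℕ} (_hn : Squarefree n)
      (_hKol : ∀ q ∈ n.primeFactors, IsKolyvaginPrime N W K 3 q ∧ FrobEqFrobInfty W K (3 ^ M) q)
      (d : (m : ℕ) → m ∣ n → KolyvaginHeegnerData Dt β ι m)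
      (m : ℕ) (hm : m ∣ n) (ℓ : ℕ) (hℓ : ℓ ∈ m.primeFactors) [Fact ℓ.Prime]
      (hΔ : ¬ (ℓ : ℤ) ∣ minimalDiscriminantInt W) (φ₀ : absoluteGaloisGroup (ZMod ℓ)),
      (∀ x : AlgebraicClosure (ZMod ℓ), φ₀ • x = x ^ ℓ) →
      ∀ (hle : ringClassField K ι (m / ℓ) ≤ ringClassField K ι m)
        (γ : ringClassField K ι m ≃ₐ[ℚ] ringClassField K ι m), γ ∈ ringClassGal ι m →
        geomReduction hΔ ((RatClosure.pointsEquiv (K := K) W).symm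
            ((d m hm).toGeomPoints (pointGalHom W (ringClassField K ι m) γ (d m hm).y))) =
          φ₀ • geomReduction hΔ ((RatClosure.pointsEquiv (K := K) W).symm
            ((d m hm).toGeomPoints (pointGalHom W (ringClassField K ι m) γ
              (WeierstrassCurve.Affine.Point.map (W' := W)
                ((RingClassField.inclusion ι hle).restrictScalars ℚ)
                (d (m / ℓ)
                  ((Nat.div_dvd_of_dvd (Nat.dvd_of_mem_primeFactors hℓ)).trans hm)).y))))) :
    ∀ [W.IsElliptic] (_hK : IsImaginaryQuadratic K) (_hH : SatisfiesHeegnerHypothesis N K)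
      {P : (W.baseChange K).toAffine.Point} (_hP : IsHeegnerPoint N W K P)
      (_hnt : ¬ IsOfFinAddOrder P) {m : ℕ}
      (_hm : ∀ Q : (W.baseChange K).toAffine.Point, 3 ^ (m + 1) • Q ≠ P) (c : W.sha),
      (∃ j : ℕ, 3 ^ j • c = 0) → 3 ^ (2 * m) • c = 0 :=
  Three.pow_smul_sha_rat_three_primary_eq_zero_of_classX11b_of_kodairaNeron_rat hW
    (poitouTate_sum_localTatePairing_eq_zero_holds K) hN
    (heegnerPointOfConductor_one_galoisConj_holds N W K) (KolyvaginLeaves.hCM_holds N W K 3)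
    (@fun _ ↦ KolyvaginLeaves.h53_holds hN 3) hKN3m hKN3a hγ

/-- **On the class X11b @ 3 ∩ (KN₃)/ℚ: `3 ∤ y_K` in `E(K)` ⟹ `Ш(E/ℚ)[3^∞] = 0`** (Mathlib:
`AddCommGroup.primaryComponent W.sha 3 = ⊥`; Gross 1991 Prop. 2.1 (2) at `p = 3` descended to
`ℚ`) — modulo ONE cite-only input `hγ` at `3`.  The tree END
`Three.primaryComponent_sha_three_eq_bot_of_classX11b_of_kodairaNeron_rat_of_not_dvd` with `hPT`,
`hrec`, `hCM`, `h53` SUPPLIED; binders/conclusion otherwise VERBATIM.  CONDITIONAL on EXACTLY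
{`hγ`} at `3` + `hN` + (KN₃)/ℚ; nothing booked; no mark.
[cite: GrossLMS1991, Prop. 2.1 (2), §3 Prop. 3.7 (2)] [cite: SerreGaloisCohomology1997, I.§2.4] -/
theorem primaryComponent_sha_three_eq_bot_of_classX11b_of_kodairaNeron_rat_of_not_dvd [NeZero N]
    [W.IsGloballyMinimal] (hW : ClassX11b W 3) (hN : ∀ [W.IsElliptic], N = W.conductorNorm ℤ)
    (hKN3m : ∀ [W.IsElliptic] (v : HeightOneSpectrum (𝓞 ℚ)),
      W.HasMultiplicativeReductionAt v → ¬ 3 ∣ W.ordMinimalDiscriminant v)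
    (hKN3a : ∀ [W.IsElliptic] (v : HeightOneSpectrum (𝓞 ℚ)), W.HasAdditiveReductionAt v →
      W.kodairaSymbolAt v ≠ KodairaSymbol.IV ∧ W.kodairaSymbolAt v ≠ KodairaSymbol.IVstar)
    (hγ : ∀ [W.IsElliptic] (_hK : IsImaginaryQuadratic K) (_hH : SatisfiesHeegnerHypothesis N K)
      (Dt : ModularParametrizationData W N) (β : ℤ) (ι : K →+* ℂ) {M : ℕ}
      (_hM : 1 ≤ M) {n : ℕ} (_hn : Squarefree n)
      (_hKol : ∀ q ∈ n.primeFactors, IsKolyvaginPrime N W K 3 q ∧ FrobEqFrobInfty W K (3 ^ M) q)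
      (d : (m : ℕ) → m ∣ n → KolyvaginHeegnerData Dt β ι m)
      (m : ℕ) (hm : m ∣ n) (ℓ : ℕ) (hℓ : ℓ ∈ m.primeFactors) [Fact ℓ.Prime]
      (hΔ : ¬ (ℓ : ℤ) ∣ minimalDiscriminantInt W) (φ₀ : absoluteGaloisGroup (ZMod ℓ)),
      (∀ x : AlgebraicClosure (ZMod ℓ), φ₀ • x = x ^ ℓ) →
      ∀ (hle : ringClassField K ι (m / ℓ) ≤ ringClassField K ι m)
        (γ : ringClassField K ι m ≃ₐ[ℚ] ringClassField K ι m), γ ∈ ringClassGal ι m →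
        geomReduction hΔ ((RatClosure.pointsEquiv (K := K) W).symm
            ((d m hm).toGeomPoints (pointGalHom W (ringClassField K ι m) γ (d m hm).y))) =
          φ₀ • geomReduction hΔ ((RatClosure.pointsEquiv (K := K) W).symm
            ((d m hm).toGeomPoints (pointGalHom W (ringClassField K ι m) γ
              (WeierstrassCurve.Affine.Point.map (W' := W)
                ((RingClassField.inclusion ι hle).restrictScalars ℚ)
                (d (m / ℓ)
                  ((Nat.div_dvd_of_dvd (Nat.dvd_of_mem_primeFactors hℓ)).trans hm)).y))))) :
    ∀ [W.IsElliptic] (_hK : IsImaginaryQuadratic K) (_hH : SatisfiesHeegnerHypothesis N K)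
      {P : (W.baseChange K).toAffine.Point} (_hP : IsHeegnerPoint N W K P)
      (_hnt : ¬ IsOfFinAddOrder P) (_h3 : ∀ Q : (W.baseChange K).toAffine.Point, 3 • Q ≠ P),
      AddCommGroup.primaryComponent W.sha 3 = ⊥ :=
  Three.primaryComponent_sha_three_eq_bot_of_classX11b_of_kodairaNeron_rat_of_not_dvd hW
    (poitouTate_sum_localTatePairing_eq_zero_holds K) hN
    (heegnerPointOfConductor_one_galoisConj_holds N W K) (KolyvaginLeaves.hCM_holds N W K 3)
    (@fun _ ↦ KolyvaginLeaves.h53_holds hN 3) hKN3m hKN3a hγ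

/-- **On the class X11b @ 3 ∩ (KN₃)/ℚ, `Ш(E/ℚ)[3^∞]` is finite — clause (ii) of `BSD(E, 3)`
(`BSDp W 3`) VERBATIM — from published NAMED FACTS and ONE cite-only input `hγ₃` (∀ `K`), with
NO `(K, y_K)` hypothesis.**  The tree END
`Three.finite_primaryComponent_sha_three_of_classX11b_of_kodairaNeron_of_facts` (named facts
{`hGZ`, `hmod`, `hnf`, `hHL`, `hMaz`, `hPT`} + cite-only {`hrec`, `hCM`, `h53`, `hγ`} ∀ `K`) with
`hPT`, `hrec`, `hCM`, `h53` SUPPLIED at every `K : Type` by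
`poitouTate_sum_localTatePairing_eq_zero_holds K`, `heegnerPointOfConductor_one_galoisConj_holds`,
`KolyvaginLeaves.hCM_holds`, `KolyvaginLeaves.h53_holds rfl 3`.  Data as there: a Hoffstein–Luo
Heegner field `K`, its Heegner point non-torsion by Gross–Zagier (`r_an = 1`).  CONDITIONAL on
EXACTLY the named facts {`gross_zagier` (∀ `N W K`), `hasEntireLFunction_rat`, `exists_isNewformOf`,
`HoffsteinLuo1997_exists_twist_L_one_ne_zero`, `mazur_not_dvd_maninConstant_of_odd`} + the ONE
cite-only input {`hγ`} at `3` for every `K` (Gross Prop. 3.7 (2); NOT discharged) + (KN₃)/ℚ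
(`hKN3m`, `hKN3a`); nothing booked; no mark / count / tier moves.
[cite: Miller2011LMS, Def. 1.1 (ii)] [cite: HoffsteinLuo1997, Theorem (§1)]
[cite: GrossZagier1986, I (6.3)] [cite: McCallumLMS1991, §1 Theorem (Kolyvagin)]
[cite: GrossLMS1991, §3 Prop. 3.7 (2)] -/
theorem finite_primaryComponent_sha_three_of_classX11b_of_kodairaNeron_of_facts [W.IsElliptic]
    [W.IsGloballyMinimal] [NeZero (W.conductorNorm ℤ)] (hX : ClassX11b W 3)
    -- published inputs (named facts of the tree)
    (hGZ : ∀ (N : ℕ) [NeZero N] (W : WeierstrassCurve ℚ) (K : Type) [Field K] [NumberField K],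
      gross_zagier N W K)
    (hmod : hasEntireLFunction_rat) (hnf : exists_isNewformOf)
    (hHL : HoffsteinLuo1997_exists_twist_L_one_ne_zero) (hMaz : mazur_not_dvd_maninConstant_of_odd)
    -- the Kodaira–Néron sub-class (KN₃)/ℚ
    (hKN3m : ∀ [W.IsElliptic] (v : HeightOneSpectrum (𝓞 ℚ)),
      W.HasMultiplicativeReductionAt v → ¬ 3 ∣ W.ordMinimalDiscriminant v)
    (hKN3a : ∀ [W.IsElliptic] (v : HeightOneSpectrum (𝓞 ℚ)), W.HasAdditiveReductionAt v →
      W.kodairaSymbolAt v ≠ KodairaSymbol.IV ∧ W.kodairaSymbolAt v ≠ KodairaSymbol.IVstar)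
    -- the ONE remaining cite-only input AT 3, for every number field `K`
    (hγ : ∀ (K : Type) [Field K] [NumberField K],
      ∀ [W.IsElliptic] (_hK : IsImaginaryQuadratic K) (_hH : SatisfiesHeegnerHypothesis (W.conductorNorm ℤ) K)
      (Dt : ModularParametrizationData W (W.conductorNorm ℤ)) (β : ℤ) (ι : K →+* ℂ) {M : ℕ}
      (_hM : 1 ≤ M) {n : ℕ} (_hn : Squarefree n)
      (_hKol : ∀ q ∈ n.primeFactors, IsKolyvaginPrime (W.conductorNorm ℤ) W K 3 q ∧ FrobEqFrobInfty W K (3 ^ M) q)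
      (d : (m : ℕ) → m ∣ n → KolyvaginHeegnerData Dt β ι m)
      (m : ℕ) (hm : m ∣ n) (ℓ : ℕ) (hℓ : ℓ ∈ m.primeFactors) [Fact ℓ.Prime]
      (hΔ : ¬ (ℓ : ℤ) ∣ minimalDiscriminantInt W) (φ₀ : absoluteGaloisGroup (ZMod ℓ)),
      (∀ x : AlgebraicClosure (ZMod ℓ), φ₀ • x = x ^ ℓ) →
      ∀ (hle : ringClassField K ι (m / ℓ) ≤ ringClassField K ι m)
        (γ : ringClassField K ι m ≃ₐ[ℚ] ringClassField K ι m), γ ∈ ringClassGal ι m →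
        geomReduction hΔ ((RatClosure.pointsEquiv (K := K) W).symm
            ((d m hm).toGeomPoints (pointGalHom W (ringClassField K ι m) γ (d m hm).y))) =
          φ₀ • geomReduction hΔ ((RatClosure.pointsEquiv (K := K) W).symm
            ((d m hm).toGeomPoints (pointGalHom W (ringClassField K ι m) γ
              (WeierstrassCurve.Affine.Point.map (W' := W)
                ((RingClassField.inclusion ι hle).restrictScalars ℚ)
                (d (m / ℓ)
                  ((Nat.div_dvd_of_dvd (Nat.dvd_of_mem_primeFactors hℓ)).trans hm)).y))))) :
    Finite (AddCommGroup.primaryComponent W.sha 3) :=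
  Three.finite_primaryComponent_sha_three_of_classX11b_of_kodairaNeron_of_facts hX hGZ hmod hnf hHL
    hMaz (fun K _ _ ↦ poitouTate_sum_localTatePairing_eq_zero_holds K)
    (fun K _ _ ↦ heegnerPointOfConductor_one_galoisConj_holds (W.conductorNorm ℤ) W K)
    (fun K _ _ ↦ KolyvaginLeaves.hCM_holds (W.conductorNorm ℤ) W K 3)
    (fun K _ _ ↦ @fun _ ↦ KolyvaginLeaves.h53_holds (K := K) (N := W.conductorNorm ℤ) rfl 3)
    hKN3m hKN3a hγ

end Summit.BirchSwinnertonDyer.Rank1Residual.X11b.Three.KolyvaginDischarged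

end
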